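import Summits.MatrixMultiplication.MatrixMultiplication.Theorems.ObstructionDescentUniversalOccurrenceTripods

set_option linter.dupNamespace false
set_option autoImplicit false

/-!
# Obstruction descent — universal occurrence below HALF THE SQUARE: `u(N) ≤ ⌈N²/2⌉` (covering codes of radius one)
# (decomp-mm · lens 3 · gen 32, fifth kernel, def-free)

`route-MatrixMultiplication-ObstructionDescent`, crux `NoOccurrenceObstruction` (`P_O`, stmt 29040); NODE-g32 §2b/§3.

The tripod criterion of the companion kernel (`uocc_of_tripodCover`: `m` tripods covering the `N`-box certify `UOCC(m,N)` through the
monomial Jacobian certificate of the NODE-g28 engine) is fed the classical covering codes of length `3` and radius `1`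
(`K_q(3,1) = ⌈q²/2⌉`): split the alphabet `{0,…,N−1}` into the halves `A = {0,…,h₁−1}`, `B = {h₁,…,N−1}` (`h₁ = ⌈N/2⌉`, `h₂ = ⌊N/2⌋`)
and take the words `(x, y, x+y)` over `A` (addition mod `h₁`) and over `B` (mod `h₂`) — `h₁² + h₂² = ⌈N²/2⌉` words; two of the three
letters of any word lie in the same half, and that half contains a code word with those two letters in those two places (a Latin square
has surjective rows and columns).  Hence (`uocc_of_halfSquare_le`): **for every `N ≥ 2` and every `m ≥ ⌈N/2⌉² + ⌊N/2⌋² = ⌈N²/2⌉`, every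
partition triple occurring in a tensor power of ANY complex tensor on an index type of cardinality `≤ N` occurs in the same tensor power of
`⟨m⟩`** — the universal-occurrence threshold satisfies `u(N) ≤ ⌈N²/2⌉`, half the slicing bound `u(N) ≤ N²` (`uocc_of_sq_le`); for the
crux: the `P_O`-cells `(n, m)` hold for all `m ≥ ⌈n⁴/2⌉` (`semigroup_le_matMul_of_halfSquare_le`).  The family version of the criterion
(`uocc_of_offsetCentres`: any family of `≤ m` centres, box-relative coordinates) is recorded for further codes.
No proposition is defined; no `def`; sorry-free; standard axioms.  Nothing here proves `ω = 2`.
[cite: LandsbergGCT2017, §4.7.1 (p. 101), §2.1.6 (p. 33)] [cite: BurgisserIkenmeyer2011, §3.1, Lemma 3.2]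
-/

noncomputable section

open scoped BigOperators

namespace Summit.MatrixMultiplication.MatrixMultiplication.Theorems.ObstructionCalculus

open Literature.Computability.AlgebraicComplexity (kroneckerPow isotypicSum₁ isotypicSum₂ isotypicSum₃ unitTensor matMulTensor)

/-! ## §1  The criterion for an arbitrary family of centres (box-relative coordinates) -/

/-- **Universal occurrence from a covering family of centres.**  Let `κ` index at most `m` centres in the box `{0,…,N−1}³` (box-relative
coordinates) such that every cell of the box agrees with some centre in two of its three coordinates.  Then `UOCC(m,N)`: every triple
occurring for any tensor of format `≤ N` occurs for `⟨m⟩` (`N ≤ m`).  Reduction to `uocc_of_tripodCover`: embed `κ ↪ Fin m`, place the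
centres in the top box of format `m`, and give the unused summands arbitrary centres. [cite: LandsbergGCT2017, §4.7.1] -/
theorem uocc_of_offsetCentres {m N : ℕ} (hNm : N ≤ m) {κ : Type} [Fintype κ] (hκ : Fintype.card κ ≤ m)
    (ctr : κ → Fin N × Fin N × Fin N)
    (hcov : ∀ x y z : Fin N, ∃ k : κ,
      ((ctr k).2.1 = y ∧ (ctr k).2.2 = z) ∨ ((ctr k).1 = x ∧ (ctr k).2.2 = z) ∨ ((ctr k).1 = x ∧ (ctr k).2.1 = y)) :
    ∀ {ι : Type} [Fintype ι], Fintype.card ι ≤ N → ∀ (s : ι → ι → ι → ℂ) (d : ℕ)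
      (lam : Fin 3 → Nat.Partition d),
      isotypicSum₁ (lam 0) (isotypicSum₂ (lam 1) (isotypicSum₃ (lam 2) (kroneckerPow s d))) ≠ 0 →
      isotypicSum₁ (lam 0) (isotypicSum₂ (lam 1) (isotypicSum₃ (lam 2) (kroneckerPow (unitTensor ℂ m) d))) ≠ 0 := by
  classical
  intro ι _ hι t d lam hocc
  -- an injection of the centre labels into the summand labels `Fin m`
  obtain ⟨e⟩ : Nonempty (κ ↪ Fin m) := Function.Embedding.nonempty_of_card_le (by simpa using hκ)
  -- box-relative ↦ absolute coordinates (the top box of format `m`)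
  let up : Fin N → Fin m := fun x => ⟨m - N + x, by omega⟩
  let coord : Fin N × Fin N × Fin N → Fin 3 → Fin N := fun p s => ![p.1, p.2.1, p.2.2] s
  let φ : Fin 3 → Fin m → Fin m := fun s l => if h : ∃ k, e k = l then up (coord (ctr h.choose) s) else l
  have hφ : ∀ (s : Fin 3) (k : κ), φ s (e k) = up (coord (ctr k) s) := by
    intro s k
    have h : ∃ k', e k' = e k := ⟨k, rfl⟩
    simp only [φ, dif_pos h]
    rw [e.injective h.choose_spec]
  refine uocc_of_tripodCover hNm φ (fun a b c ha hb hc => ?_) hι t d lam hocc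
  obtain ⟨k, hk⟩ := hcov ⟨a - (m - N), by omega⟩ ⟨b - (m - N), by omega⟩ ⟨c - (m - N), by omega⟩
  have hupa : up ⟨a - (m - N), by omega⟩ = a := Fin.ext (by simp [up]; omega)
  have hupb : up ⟨b - (m - N), by omega⟩ = b := Fin.ext (by simp [up]; omega)
  have hupc : up ⟨c - (m - N), by omega⟩ = c := Fin.ext (by simp [up]; omega)
  rcases hk with ⟨h1, h2⟩ | ⟨h0, h2⟩ | ⟨h0, h1⟩
  · refine ⟨(0, a, e k), by simp, ?_, ?_⟩
    · simp only [Fin.isValue, zero_ne_one, if_false, hφ, coord, Matrix.cons_val_one, Matrix.cons_val_zero, h1, hupb]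
    · simp only [Fin.isValue, Fin.reduceEq, if_false, hφ, coord, Matrix.cons_val_two, Matrix.tail_cons,
        Matrix.head_cons, h2, hupc]
  · refine ⟨(1, b, e k), ?_, by simp, ?_⟩
    · simp only [Fin.isValue, one_ne_zero, if_false, hφ, coord, Matrix.cons_val_zero, h0, hupa]
    · simp only [Fin.isValue, Fin.reduceEq, if_false, hφ, coord, Matrix.cons_val_two, Matrix.tail_cons,
        Matrix.head_cons, h2, hupc]
  · refine ⟨(2, c, e k), ?_, ?_, by simp⟩
    · simp only [Fin.isValue, Fin.reduceEq, if_false, hφ, coord, Matrix.cons_val_zero, h0, hupa]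
    · simp only [Fin.isValue, Fin.reduceEq, if_false, hφ, coord, Matrix.cons_val_one, Matrix.cons_val_zero, h1, hupb]

/-! ## §2  The `⌈N²/2⌉` covering code -/

/-- **`u(N) ≤ ⌈N²/2⌉`: universal occurrence from half the square on.**  For `N ≥ 2` and `m ≥ ⌈N/2⌉² + ⌊N/2⌋² (= ⌈N²/2⌉)`, every
partition triple occurring in a tensor power of ANY complex tensor on an index type of cardinality `≤ N` occurs in the same tensor power
of the unit tensor `⟨m⟩`.  The centres are the words `(x, y, x + y)` over the half `{0,…,⌈N/2⌉−1}` (addition mod `⌈N/2⌉`) and over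
the half `{⌈N/2⌉,…,N−1}` (mod `⌊N/2⌋`): a covering code of radius one (two letters of any word share a half; rows and columns of the
addition table are surjective), fed to `uocc_of_offsetCentres`.  (Monomial certificates cannot go below `⌈N²/2⌉ = K_N(3,1)`; the true
threshold is conjecturally far lower, NODE-g32 §3.) [cite: LandsbergGCT2017, §4.7.1 (p. 101), §2.1.6 (p. 33)]
[cite: BurgisserIkenmeyer2011, §3.1, Lemma 3.2] -/
theorem uocc_of_halfSquare_le {m N : ℕ} (h2 : 2 ≤ N) (hm : ((N + 1) / 2) ^ 2 + (N / 2) ^ 2 ≤ m) :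
    ∀ {ι : Type} [Fintype ι], Fintype.card ι ≤ N → ∀ (s : ι → ι → ι → ℂ) (d : ℕ)
      (lam : Fin 3 → Nat.Partition d),
      isotypicSum₁ (lam 0) (isotypicSum₂ (lam 1) (isotypicSum₃ (lam 2) (kroneckerPow s d))) ≠ 0 →
      isotypicSum₁ (lam 0) (isotypicSum₂ (lam 1) (isotypicSum₃ (lam 2) (kroneckerPow (unitTensor ℂ m) d))) ≠ 0 := by
  classical
  intro ι _ hι t d lam hocc
  -- the two halves
  set h₁ : ℕ := (N + 1) / 2 with hh₁
  set h₂ : ℕ := N / 2 with hh₂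
  have hN : h₁ + h₂ = N := by omega
  have h₁pos : 0 < h₁ := by omega
  have h₂pos : 0 < h₂ := by omega
  haveI : NeZero h₁ := ⟨h₁pos.ne'⟩
  haveI : NeZero h₂ := ⟨h₂pos.ne'⟩
  have hNm : N ≤ m := by nlinarith
  let inA : Fin h₁ → Fin N := fun x => ⟨x, by omega⟩
  let inB : Fin h₂ → Fin N := fun x => ⟨h₁ + x, by omega⟩
  let ctr : (Fin h₁ × Fin h₁) ⊕ (Fin h₂ × Fin h₂) → Fin N × Fin N × Fin N := fun k =>
    match k with
    | Sum.inl (x, y) => (inA x, inA y, inA (x + y))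
    | Sum.inr (x, y) => (inB x, inB y, inB (x + y))
  have hcard : Fintype.card ((Fin h₁ × Fin h₁) ⊕ (Fin h₂ × Fin h₂)) ≤ m := by
    simp only [Fintype.card_sum, Fintype.card_prod, Fintype.card_fin]
    nlinarith
  refine uocc_of_offsetCentres hNm hcard ctr (fun x y z => ?_) hι t d lam hocc
  -- classify the three letters
  by_cases hx : (x : ℕ) < h₁ <;> by_cases hy : (y : ℕ) < h₁
  · -- x, y ∈ A
    refine ⟨Sum.inl (⟨x, hx⟩, ⟨y, hy⟩), Or.inr (Or.inr ⟨Fin.ext rfl, Fin.ext rfl⟩)⟩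
  · by_cases hz : (z : ℕ) < h₁
    · -- x, z ∈ A : word (x, z - x, z)
      refine ⟨Sum.inl (⟨x, hx⟩, ⟨z, hz⟩ - ⟨x, hx⟩), Or.inr (Or.inl ⟨Fin.ext rfl, ?_⟩)⟩
      show inA (⟨x, hx⟩ + (⟨z, hz⟩ - ⟨x, hx⟩)) = z
      rw [add_sub_cancel]
    · -- y, z ∈ B : word (z - y, y, z) over B
      have hy' : (y : ℕ) - h₁ < h₂ := by omega
      have hz' : (z : ℕ) - h₁ < h₂ := by omega
      refine ⟨Sum.inr (⟨(z : ℕ) - h₁, hz'⟩ - ⟨(y : ℕ) - h₁, hy'⟩, ⟨(y : ℕ) - h₁, hy'⟩), Or.inl ⟨Fin.ext ?_, ?_⟩⟩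
      · show h₁ + ((y : ℕ) - h₁) = (y : ℕ)
        omega
      · show inB (⟨(z : ℕ) - h₁, hz'⟩ - ⟨(y : ℕ) - h₁, hy'⟩ + ⟨(y : ℕ) - h₁, hy'⟩) = z
        rw [sub_add_cancel]
        exact Fin.ext (by simp [inB]; omega)
  · by_cases hz : (z : ℕ) < h₁
    · -- y, z ∈ A : word (z - y, y, z)
      refine ⟨Sum.inl (⟨z, hz⟩ - ⟨y, hy⟩, ⟨y, hy⟩), Or.inl ⟨Fin.ext rfl, ?_⟩⟩
      show inA (⟨z, hz⟩ - ⟨y, hy⟩ + ⟨y, hy⟩) = z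
      rw [sub_add_cancel]
    · -- x, z ∈ B : word (x, z - x, z) over B
      have hx' : (x : ℕ) - h₁ < h₂ := by omega
      have hz' : (z : ℕ) - h₁ < h₂ := by omega
      refine ⟨Sum.inr (⟨(x : ℕ) - h₁, hx'⟩, ⟨(z : ℕ) - h₁, hz'⟩ - ⟨(x : ℕ) - h₁, hx'⟩), Or.inr (Or.inl ⟨Fin.ext ?_, ?_⟩)⟩
      · show h₁ + ((x : ℕ) - h₁) = (x : ℕ)
        omega
      · show inB (⟨(x : ℕ) - h₁, hx'⟩ + (⟨(z : ℕ) - h₁, hz'⟩ - ⟨(x : ℕ) - h₁, hx'⟩)) = z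
        rw [add_sub_cancel]
        exact Fin.ext (by simp [inB]; omega)
  · -- x, y ∈ B
    have hx' : (x : ℕ) - h₁ < h₂ := by omega
    have hy' : (y : ℕ) - h₁ < h₂ := by omega
    refine ⟨Sum.inr (⟨(x : ℕ) - h₁, hx'⟩, ⟨(y : ℕ) - h₁, hy'⟩), Or.inr (Or.inr ⟨Fin.ext ?_, Fin.ext ?_⟩)⟩
    · show h₁ + ((x : ℕ) - h₁) = (x : ℕ)
      omega
    · show h₁ + ((y : ℕ) - h₁) = (y : ℕ)
      omega

/-- **The `P_O`-cells `(n, m)` hold for all `m ≥ ⌈n⁴/2⌉` (`n ≥ 2`)**: every type occurring for `⟨n,n,n⟩` occurs for `⟨m⟩`, from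
`u(n²) ≤ ⌈n⁴/2⌉` and `semigroup_le_matMul_of_uocc` — half the slicing threshold `n⁴` of `uocc_sq_of_pow_four_le`.
[cite: BurgisserIkenmeyer2011, §3.1, Lemma 3.2] -/
theorem semigroup_le_matMul_of_halfSquare_le {n m : ℕ} (hn : 2 ≤ n) (hm : ((n * n + 1) / 2) ^ 2 + (n * n / 2) ^ 2 ≤ m) {d : ℕ}
    (lam : Fin 3 → Nat.Partition d)
    (hocc : isotypicSum₁ (lam 0) (isotypicSum₂ (lam 1) (isotypicSum₃ (lam 2) (kroneckerPow (matMulTensor ℂ n n n) d))) ≠ 0) :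
    isotypicSum₁ (lam 0) (isotypicSum₂ (lam 1) (isotypicSum₃ (lam 2) (kroneckerPow (unitTensor ℂ m) d))) ≠ 0 :=
  semigroup_le_matMul_of_uocc (N := n * n) le_rfl (uocc_of_halfSquare_le (by nlinarith) hm) d lam hocc

end Summit.MatrixMultiplication.MatrixMultiplication.Theorems.ObstructionCalculus

end
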